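import Summits.BirchSwinnertonDyer.Rank1Residual.GaloisImage.CongruenceVisibilityPotMult
import Literature.NumberTheory.EllipticCurves.ComplexMultiplicationHasCMThirteenProofs
import HarnessLib

/-!
# Kind (iii′) numerals in the kernel — PILOT pair 2601h1 ~ 2601l1 at the place of `3`
# (cell `b2b-bsdres`, team n1011, row T-VIS3-TATE; seat p09 GEN 11; FILE M3, self-test of the
# records recipe `TwistedKummer.kindIIIPrime_numerals_three_of_certs`)

HONEST FRAMING (cell `b2b-bsdres`, run/shared/lean/b2b/bsd-rank1-residual/, verbatim in every
file): the goal of the cell is to DELETE the COMBINATION-SHAPED residual classes of the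
Birch–Swinnerton-Dyer formula for ALL analytic-rank `≤ 1` elliptic curves over `ℚ` — "full BSD
formula for every rank `≤ 1` curve in class `C`" assembled STRICTLY from published theorems — so
that the rank-`≤ 1` remainder becomes exactly the CONSTRUCTION-SHAPED classes, which are TYPED
(missing-input `Prop`s), NOT attempted. This is not "finishing BSD". Team n1011 (N10 / N11, the
additive block X4 ∧ `p = 3`): research route on the CONSTRUCTION-SHAPED class X4; no claim beyond
the stated classes; nothing is booked; no mark / label / count is changed by this file. ONE
per-pair kernel instance (theorem only; no definition, no named fact, no `sorry`); it closes
NOTHING by itself — the congruence `E[3] ≅ E′[3]`, the ranks and the other places of the pair stay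
EVIDENCE columns of the records lanes (r1 ROUTE-1 §42 road PASS-T).

## What

`TwistedKummer.kindIIIPrime_numerals_2601h1_2601l1_at3`: for the Cremona models
`E = 2601h1 = [1, −1, 0, −59877, −3934008]` (an N11 target: `X4 ∧ p = 3`, analytic rank `0`,
additive potentially-multiplicative at `3`, `ord₃ j = −4`) and `E′ = 2601l1 = [0, 0, 1, 51, 72]`
(rank `2`, additive potentially-multiplicative at `3`, `ord₃ j = −1`) — r1's census
`route1/g30_tate3_rows.tsv` first PASS-T row, partner data "vj = −4, −1; tw = χ₋₃, χ₋₃; sq = Y" — the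
SIXTH free kind of `exists_sha_ne_zero_of_congr_of_places₆` holds at the place `v` of `3` in the
kernel: `1 < v(j(E))`, `1 < v(j(E′))`, `γ(E) = r² γ(E′)` in `ℚ_v` (`γ = −c₄/c₆`:
`γ(E)/γ(E′) = 65/3026`, `65 · 3026 ≡ 1 (mod 3)`, a `3`-adic unit square), `μ₃(ℚ_v) = 1`. Inputs:
`j(E) = 274625/81`, `j(E′) = 4096/3` (tree `j_eq_c₄_pow_three_div_Δ` + `norm_num` on the models), `3 ∣ den` (`decide`), p17's
square flags `sqFlagAt 3 (65·3026) 0 = true`, `sqFlagAt 3 (−3) 1 = false` (`decide`).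

References: [Cremona2006] Table 1 (labels 2601h1, 2601l1); [SilvermanATAEC1994] V.5.2–5.4;
[CremonaMazur2000] §3.
-/

noncomputable section

open scoped Classical
open Field NumberField IsDedekindDomain WeierstrassCurve Rat.HeightOneSpectrum
open Literature.NumberTheory.EllipticCurves

namespace Summit.BirchSwinnertonDyer.Rank1Residual.GaloisImage

namespace TwistedKummer

/-- **2601h1 ~ 2601l1 at `v = 3`: the kind-(iii′) numerals** (`1 < v(j)` twice, same twist class,
`μ₃(ℚ_v) = 1`) — the sixth disjunct of `exists_sha_ne_zero_of_congr_of_places₆` at the place of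
`3` for this pair, by `kindIIIPrime_numerals_three_of_certs`. [cite: Cremona2006, Table 1 (Cremona
labels 2601h1, 2601l1)] [cite: SilvermanATAEC1994, Ch. V Lemma 5.2 (c), Thm. 5.3, Cor. 5.4] -/
theorem kindIIIPrime_numerals_2601h1_2601l1_at3 (W W' : WeierstrassCurve ℚ) [W.IsElliptic]
    [W'.IsElliptic] (hW : W = ⟨1, -1, 0, -59877, -3934008⟩) (hW' : W' = ⟨0, 0, 1, 51, 72⟩)
    {v : HeightOneSpectrum (𝓞 ℚ)} (hv : (primesEquiv v : ℕ) = 3) :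
    1 < v.valuation ℚ W.j ∧ 1 < v.valuation ℚ W'.j ∧
      (∃ r : v.adicCompletion ℚ, algebraMap ℚ (v.adicCompletion ℚ) (-(W.c₄ / W.c₆)) =
        r ^ 2 * algebraMap ℚ (v.adicCompletion ℚ) (-(W'.c₄ / W'.c₆))) ∧
      (∀ ζ : v.adicCompletion ℚ, ζ ^ 3 = 1 → ζ = 1) := by
  haveI : Fact (Nat.Prime 3) := ⟨Nat.prime_three⟩
  have hj : W.j = 274625 / 81 := by
    rw [WeierstrassCurve.j_eq_c₄_pow_three_div_Δ]; subst hW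
    norm_num [WeierstrassCurve.c₄, WeierstrassCurve.Δ, WeierstrassCurve.b₂, WeierstrassCurve.b₄,
      WeierstrassCurve.b₆, WeierstrassCurve.b₈]
  have hj' : W'.j = 4096 / 3 := by
    rw [WeierstrassCurve.j_eq_c₄_pow_three_div_Δ]; subst hW'
    norm_num [WeierstrassCurve.c₄, WeierstrassCurve.Δ, WeierstrassCurve.b₂, WeierstrassCurve.b₄,
      WeierstrassCurve.b₆, WeierstrassCurve.b₈]
  have hA : -(W.c₄ / W.c₆) = -65 / 77163 := by
    subst hW
    norm_num [WeierstrassCurve.c₄, WeierstrassCurve.c₆, WeierstrassCurve.b₂, WeierstrassCurve.b₄,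
      WeierstrassCurve.b₆]
  have hB : -(W'.c₄ / W'.c₆) = -2 / 51 := by
    subst hW'
    norm_num [WeierstrassCurve.c₄, WeierstrassCurve.c₆, WeierstrassCurve.b₂, WeierstrassCurve.b₄,
      WeierstrassCurve.b₆]
  exact kindIIIPrime_numerals_three_of_certs v hv W W' hj (by norm_num) (by decide +kernel) hj'
    (by norm_num) (by decide +kernel) hA hB (by norm_num) (N := 65) (D := 3026) (by norm_num)
    (by norm_num) (w := 0) (by norm_num) (by norm_num) (by decide +kernel) (w₃ := 1) (by norm_num)
    (by norm_num) (by decide +kernel)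

end TwistedKummer

end Summit.BirchSwinnertonDyer.Rank1Residual.GaloisImage

end
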